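import Summits.ValiantsHypothesis.ValiantsHypothesis.Theorems.KPlusLogSqLawTropicalBDisplacement

/-!
# Route «KPlusLogSqLaw», crux `TropicalB` (stmt-ValiantsHypothesis-19771) — SCALE-CARRY LAW, part 1 (combinatorics):
# the lexicographic step lemma for `c`-separated scales and the layer cake of the compressed potential

HONEST FRAMING.  Helper toward the registered stubs `stub_tropThin` / `stub_tropFat` / `stub_tropTowerLog` of
`Cruxes/TropicalB/Lines/birth.lean` (crux `Summit.ValiantsHypothesis.ValiantsHypothesis.Theses.KPlusLogSqLaw.TropicalB`, item
`stmt-ValiantsHypothesis-19771`, route `KPlusLogSqLaw`; cell `pub-symmetroid`, seat val-sym-trop-p1 g10, 2026-08-27;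
`--supports … --as helper`).  Pure counting lemmas about CLASS MAPS `Fin m → Fin K` grouped into scales `sc : Fin K → ℕ`, `sc < s`;
no design, no dominance, nothing on `TropicalB` in its window, `WeakLifting`, the doors, `MatrixDescartes` (stmt-ValiantsHypothesis-18050)
or VP ≠ VNP.  The design-level law (only LONG SCALE-CARRIES of a dominant chain are charged) is the companion file
`KPlusLogSqLawTropicalBScaleCarries.lean`.

OBJECTS.  For a class map `λ` with scale profile `N_t = #{b : sc (λ b) = t}` (`t < s`), a base `B : ℕ → ℕ` and weights `W : ℕ → ℕ`:
base sum `Σ_t N_t·B t = Σ_b B (sc (λ b))`, compressed potential `Σ_t N_t·W t = Σ_b W (sc (λ b))`, upper scale counts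
`U_t = #{b : t ≤ sc (λ b)}`.  The base is `c`-SEPARATED with spread `Δ` if `c·(B t + Δ) < B t'` for `t < t' < s`; the weights are
COMPRESSED if `c·W t + 1 ≤ W t'` for `t < t' < s` (e.g. `W t = Σ_{i<t} c^i`, `geom_compressed`; `W t ≤ (c+1)^t`, `geom_le_pow`).

* `lexStep` — **LEX STEP LEMMA** (abstract, on profiles `N, N' : ℕ → ℕ` of equal mass): if the positive part `Σ_t (N' t − N t)⁺ ≤ c`
  and the base sum drops by less than `cΔ + 1` (`Σ N·B + 1 ≤ Σ N'·B + cΔ`), then either `N = N'` on `range s` or `Σ N·W + 1 ≤ Σ N'·W`: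
  the TOP changed scale must gain (else the base sum drops by `≥ cΔ + 1`, since `c` units placed below `t*` are worth `< B t* − cΔ`),
  and one unit at `t*` outweighs the `≤ c` lost units below it (`W t* ≥ c·W t + 1`).
* `sum_eq_sum_card_mul`, `sum_card_fiber`, `sum_card_tsub_le_card_ne` (positive part ≤ number of columns whose scale changed),
  `sum_le_sum_add_mul_card_ne` (a `Δ`-bounded summand moves by `≤ Δ` per changed column) — the bridges from class maps to profiles.
* `sum_weight_eq_layers` — LAYER CAKE `Σ_b W (f b) = m·W 0 + Σ_{j<s} (W (j+1) − W j)·#{b : j+1 ≤ f b}`; whence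
  `sum_weight_lt_of_upper_le` — **DOMINANCE STEP**: if every upper scale count weakly increases and the profiles differ, the compressed
  potential rises by `≥ 1` for any weights strictly increasing below `s` (the `W = id` case is …ExchangeSector `rankSum_lt_of_upper_le`).
[folklore-level counting; the packaging is the cell's]
-/

set_option linter.dupNamespace false
set_option autoImplicit false

namespace Summit.ValiantsHypothesis.ValiantsHypothesis.Theorems.KPlusLogSqLaw.ScaleCarries

open scoped BigOperators
open Finset

/-! ## 1. Arithmetic of positive parts -/

/-- balance of positive parts: if two `ℕ`-sequences have the same sum on `range s`, their truncated differences have the same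
sum in both directions. [folklore] -/
theorem sum_tsub_eq_sum_tsub {s : ℕ} (N N' : ℕ → ℕ) (hsum : ∑ t ∈ range s, N t = ∑ t ∈ range s, N' t) :
    ∑ t ∈ range s, (N' t - N t) = ∑ t ∈ range s, (N t - N' t) := by
  have h : ∀ t, N t + (N' t - N t) = N' t + (N t - N' t) := fun t => by omega
  have := sum_congr rfl (s₁ := range s) (fun t _ => h t)
  rw [sum_add_distrib, sum_add_distrib, hsum] at this
  omega

/-- weighted balance: `Σ N'·X + Σ (N−N')⁺·X = Σ N·X + Σ (N'−N)⁺·X`. [folklore] -/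
theorem sum_mul_add_sum_tsub_mul {s : ℕ} (N N' X : ℕ → ℕ) :
    ∑ t ∈ range s, N' t * X t + ∑ t ∈ range s, (N t - N' t) * X t =
      ∑ t ∈ range s, N t * X t + ∑ t ∈ range s, (N' t - N t) * X t := by
  rw [← sum_add_distrib, ← sum_add_distrib]
  refine sum_congr rfl fun t _ => ?_
  have h : N' t + (N t - N' t) = N t + (N' t - N t) := by omega
  calc N' t * X t + (N t - N' t) * X t = (N' t + (N t - N' t)) * X t := by ring
    _ = (N t + (N' t - N t)) * X t := by rw [h]
    _ = N t * X t + (N' t - N t) * X t := by ring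

/-! ## 2. The abstract lexicographic step lemma -/

/-- **LEX STEP LEMMA.**  Scales `t < s` with a `c`-separated base `B` (`c·(B t + Δ) < B t'` for `t < t'`) and compressed weights `W`
(`c·W t + 1 ≤ W t'` for `t < t'`), `1 ≤ c`.  If two scale profiles `N, N'` have equal mass, positive part `Σ (N' − N)⁺ ≤ c`, and the
base sum does not drop by more than `cΔ − 1` (`Σ N·B + 1 ≤ Σ N'·B + cΔ`), then either the profiles agree on `range s` or the compressed
potential rises: `Σ N·W + 1 ≤ Σ N'·W`. [this file] -/
theorem lexStep {s : ℕ} (c Δ : ℕ) (hc : 1 ≤ c) (B W : ℕ → ℕ)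
    (hB : ∀ t t', t < t' → t' < s → c * (B t + Δ) < B t')
    (hW : ∀ t t', t < t' → t' < s → c * W t + 1 ≤ W t')
    (N N' : ℕ → ℕ) (hsum : ∑ t ∈ range s, N t = ∑ t ∈ range s, N' t)
    (hpos : ∑ t ∈ range s, (N' t - N t) ≤ c)
    (hG : ∑ t ∈ range s, N t * B t + 1 ≤ ∑ t ∈ range s, N' t * B t + c * Δ) :
    (∀ t ∈ range s, N t = N' t) ∨ ∑ t ∈ range s, N t * W t + 1 ≤ ∑ t ∈ range s, N' t * W t := by
  classical
  by_cases hall : ∀ t ∈ range s, N t = N' t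
  · exact Or.inl hall
  right
  push Not at hall
  -- the top changed scale
  set T : Finset ℕ := (range s).filter fun t => N t ≠ N' t with hT
  have hTne : T.Nonempty := by
    obtain ⟨t, ht, hne⟩ := hall
    exact ⟨t, mem_filter.mpr ⟨ht, hne⟩⟩
  set u := T.max' hTne with hu
  have huT : u ∈ T := max'_mem T hTne
  have hus : u < s := mem_range.mp (mem_filter.mp huT).1
  have hune : N u ≠ N' u := (mem_filter.mp huT).2
  have habove : ∀ t ∈ range s, u < t → N t = N' t := by
    intro t ht hut
    by_contra hne
    have : t ≤ u := le_max' T t (mem_filter.mpr ⟨ht, hne⟩)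
    omega
  -- positive and negative parts vanish above `u`
  have hbal := sum_tsub_eq_sum_tsub N N' hsum
  -- the negative part also has total ≤ c
  have hneg : ∑ t ∈ range s, (N t - N' t) ≤ c := hbal ▸ hpos
  rcases lt_or_gt_of_ne hune with hlt | hgt
  · -- Case B: the top changed scale GAINS (`N u < N' u`): the potential rises.
    -- some scale loses, and it lies below `u`
    have hWu : ∀ t ∈ range s, (N t - N' t) * (c * W t + 1) ≤ (N t - N' t) * W u := by
      intro t ht
      rcases lt_trichotomy t u with htu | rfl | hut
      · exact Nat.mul_le_mul_left _ (hW t u htu hus)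
      · simp [Nat.sub_eq_zero_of_le hlt.le]
      · simp [habove t ht hut]
    -- c · Σ (N−N')⁺ W + Σ (N−N')⁺ ≤ (Σ (N−N')⁺) · W u ≤ c · W u
    have h1 : c * ∑ t ∈ range s, (N t - N' t) * W t + ∑ t ∈ range s, (N t - N' t) ≤ c * W u := by
      have e : c * ∑ t ∈ range s, (N t - N' t) * W t + ∑ t ∈ range s, (N t - N' t) =
          ∑ t ∈ range s, (N t - N' t) * (c * W t + 1) := by
        rw [mul_sum, ← sum_add_distrib]
        exact sum_congr rfl fun t _ => by ring
      rw [e]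
      calc ∑ t ∈ range s, (N t - N' t) * (c * W t + 1) ≤ ∑ t ∈ range s, (N t - N' t) * W u := sum_le_sum hWu
        _ = (∑ t ∈ range s, (N t - N' t)) * W u := by rw [sum_mul]
        _ ≤ c * W u := Nat.mul_le_mul_right _ hneg
    -- the negative part is nonzero (mass balance), hence Σ (N−N')⁺·W + 1 ≤ W u
    have hnegpos : 1 ≤ ∑ t ∈ range s, (N t - N' t) := by
      rw [← hbal]
      calc 1 ≤ N' u - N u := by omega
        _ ≤ ∑ t ∈ range s, (N' t - N t) := single_le_sum (f := fun t => N' t - N t) (fun _ _ => Nat.zero_le _)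
            (mem_range.mpr hus)
    have h2 : ∑ t ∈ range s, (N t - N' t) * W t + 1 ≤ W u := by
      by_contra hcon
      push Not at hcon
      have : c * W u < c * (∑ t ∈ range s, (N t - N' t) * W t + 1) := by
        exact Nat.mul_lt_mul_of_pos_left hcon (by omega)
      nlinarith
    -- the positive part carries at least `W u`
    have h3 : W u ≤ ∑ t ∈ range s, (N' t - N t) * W t := by
      calc W u ≤ (N' u - N u) * W u := Nat.le_mul_of_pos_left _ (by omega)
        _ ≤ ∑ t ∈ range s, (N' t - N t) * W t :=
            single_le_sum (f := fun t => (N' t - N t) * W t) (fun _ _ => Nat.zero_le _) (mem_range.mpr hus)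
    have h4 := sum_mul_add_sum_tsub_mul (s := s) N N' W
    omega
  · -- Case A: the top changed scale LOSES (`N' u < N u`): impossible, the base sum would drop by more than `cΔ`.
    exfalso
    have hBu : ∀ t ∈ range s, c * ((N' t - N t) * B t) + (N' t - N t) * (c * Δ + 1) ≤ (N' t - N t) * B u := by
      intro t ht
      rcases lt_trichotomy t u with htu | rfl | hut
      · have := hB t u htu hus
        have e : c * ((N' t - N t) * B t) + (N' t - N t) * (c * Δ + 1) = (N' t - N t) * (c * (B t + Δ) + 1) := by ring
        rw [e]
        exact Nat.mul_le_mul_left _ this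
      · simp [Nat.sub_eq_zero_of_le hgt.le]
      · simp [habove t ht hut]
    have h1 : c * ∑ t ∈ range s, (N' t - N t) * B t + (∑ t ∈ range s, (N' t - N t)) * (c * Δ + 1) ≤
        (∑ t ∈ range s, (N' t - N t)) * B u := by
      calc c * ∑ t ∈ range s, (N' t - N t) * B t + (∑ t ∈ range s, (N' t - N t)) * (c * Δ + 1)
          = ∑ t ∈ range s, (c * ((N' t - N t) * B t) + (N' t - N t) * (c * Δ + 1)) := by
            rw [mul_sum, sum_mul, ← sum_add_distrib]
        _ ≤ ∑ t ∈ range s, (N' t - N t) * B u := sum_le_sum hBu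
        _ = (∑ t ∈ range s, (N' t - N t)) * B u := by rw [sum_mul]
    -- the positive part is nonzero (mass balance with the loss at `u`)
    have hpospos : 1 ≤ ∑ t ∈ range s, (N' t - N t) := by
      rw [hbal]
      calc 1 ≤ N u - N' u := by omega
        _ ≤ ∑ t ∈ range s, (N t - N' t) := single_le_sum (f := fun t => N t - N' t) (fun _ _ => Nat.zero_le _)
            (mem_range.mpr hus)
    -- hence Σ (N'−N)⁺·B + cΔ + 1 ≤ B u
    have h2 : ∑ t ∈ range s, (N' t - N t) * B t + (c * Δ + 1) ≤ B u := by
      set P := ∑ t ∈ range s, (N' t - N t) with hP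
      set SB := ∑ t ∈ range s, (N' t - N t) * B t with hSB
      by_contra hcon
      push Not at hcon
      have hcon' : B u ≤ SB + c * Δ := by omega
      have hm : P * B u ≤ P * (SB + c * Δ) := Nat.mul_le_mul_left P hcon'
      have hPc : P * SB ≤ c * SB := Nat.mul_le_mul_right SB hpos
      nlinarith
    -- and the loss at `u` costs at least `B u`
    have h3 : B u ≤ ∑ t ∈ range s, (N t - N' t) * B t := by
      calc B u ≤ (N u - N' u) * B u := Nat.le_mul_of_pos_left _ (by omega)
        _ ≤ ∑ t ∈ range s, (N t - N' t) * B t :=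
            single_le_sum (f := fun t => (N t - N' t) * B t) (fun _ _ => Nat.zero_le _) (mem_range.mpr hus)
    have h4 := sum_mul_add_sum_tsub_mul (s := s) N N' B
    omega

/-! ## 3. Scale profiles of a class map -/

section Terms

variable {m K : ℕ}

/-- fiberwise evaluation: `Σ_b X (f b) = Σ_{t<s} #{b : f b = t}·X t` when `f < s`. [folklore] -/
theorem sum_eq_sum_card_mul {s : ℕ} (f : Fin m → ℕ) (hf : ∀ b, f b < s) (X : ℕ → ℕ) :
    ∑ b, X (f b) = ∑ t ∈ range s, (univ.filter fun b => f b = t).card * X t := by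
  rw [← sum_fiberwise_of_maps_to (s := univ) (t := range s) (g := f) (fun b _ => mem_range.mpr (hf b))
    (f := fun b => X (f b))]
  refine sum_congr rfl fun t _ => ?_
  rw [sum_congr rfl (g := fun _ => X t) (fun b hb => by rw [(mem_filter.mp hb).2]), sum_const, smul_eq_mul]

/-- the scale profile has total mass `m`. [folklore] -/
theorem sum_card_fiber {s : ℕ} (f : Fin m → ℕ) (hf : ∀ b, f b < s) :
    ∑ t ∈ range s, (univ.filter fun b => f b = t).card = m := by
  have h := sum_eq_sum_card_mul f hf (fun _ => 1)
  simp only [mul_one, sum_const, card_univ, Fintype.card_fin, smul_eq_mul] at h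
  exact h.symm

/-- the positive part of the profile change is at most the number of columns whose scale changed. [folklore] -/
theorem sum_card_tsub_le_card_ne {s : ℕ} (f f' : Fin m → ℕ) (hf' : ∀ b, f' b < s) :
    ∑ t ∈ range s, ((univ.filter fun b => f' b = t).card - (univ.filter fun b => f b = t).card) ≤
      (univ.filter fun b => f' b ≠ f b).card := by
  classical
  -- fibre of `f'` at `t` ⊆ fibre of `f` at `t` ∪ (changed columns with `f' = t`)
  have hle : ∀ t, (univ.filter fun b => f' b = t).card - (univ.filter fun b => f b = t).card ≤
      ((univ.filter fun b => f' b ≠ f b).filter fun b => f' b = t).card := by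
    intro t
    have hsub : (univ.filter fun b => f' b = t) ⊆
        (univ.filter fun b => f b = t) ∪ ((univ.filter fun b => f' b ≠ f b).filter fun b => f' b = t) := by
      intro b hb
      simp only [mem_filter, mem_univ, true_and, mem_union] at hb ⊢
      by_cases h : f b = t
      · exact Or.inl h
      · exact Or.inr ⟨by rw [hb]; exact Ne.symm h, hb⟩
    have := (card_le_card hsub).trans (card_union_le _ _)
    omega
  calc ∑ t ∈ range s, ((univ.filter fun b => f' b = t).card - (univ.filter fun b => f b = t).card)
      ≤ ∑ t ∈ range s, ((univ.filter fun b => f' b ≠ f b).filter fun b => f' b = t).card := sum_le_sum fun t _ => hle t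
    _ = (univ.filter fun b => f' b ≠ f b).card :=
        (card_eq_sum_card_fiberwise (f := f') fun b _ => mem_range.mpr (hf' b)).symm

/-- a bounded summand changes the sum by at most `Δ` per changed column. [folklore] -/
theorem sum_le_sum_add_mul_card_ne (r₁ r₂ : Fin m → Fin K) (g : Fin K → ℕ) (Δ : ℕ) (hg : ∀ l, g l ≤ Δ) :
    ∑ b, g (r₂ b) ≤ ∑ b, g (r₁ b) + Δ * (univ.filter fun b => r₂ b ≠ r₁ b).card := by
  classical
  rw [← sum_filter_add_sum_filter_not univ (fun b => r₂ b ≠ r₁ b) (fun b => g (r₂ b)),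
    ← sum_filter_add_sum_filter_not univ (fun b => r₂ b ≠ r₁ b) (fun b => g (r₁ b))]
  have h1 : ∑ b ∈ univ.filter (fun b => r₂ b ≠ r₁ b), g (r₂ b) ≤ Δ * (univ.filter fun b => r₂ b ≠ r₁ b).card := by
    calc ∑ b ∈ univ.filter (fun b => r₂ b ≠ r₁ b), g (r₂ b) ≤ ∑ b ∈ univ.filter (fun b => r₂ b ≠ r₁ b), Δ :=
          sum_le_sum fun b _ => hg _
      _ = Δ * (univ.filter fun b => r₂ b ≠ r₁ b).card := by rw [sum_const, smul_eq_mul, mul_comm]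
  have h2 : ∑ b ∈ univ.filter (fun b => ¬ r₂ b ≠ r₁ b), g (r₂ b) = ∑ b ∈ univ.filter (fun b => ¬ r₂ b ≠ r₁ b), g (r₁ b) :=
    sum_congr rfl fun b hb => by
      have : r₂ b = r₁ b := by simpa using (mem_filter.mp hb).2
      rw [this]
  omega

/-- telescoping of monotone weights below `s`: `W t = W 0 + Σ_{j<t} (W (j+1) − W j)` for `t < s`. [folklore] -/
theorem weight_eq_telescope {s : ℕ} (W : ℕ → ℕ) (hmono : ∀ j, j + 1 < s → W j ≤ W (j + 1)) (t : ℕ) (ht : t < s) :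
    W t = W 0 + ∑ j ∈ range t, (W (j + 1) - W j) := by
  induction t with
  | zero => simp
  | succ t ih =>
    rw [sum_range_succ, ← add_assoc, ← ih (by omega)]
    have := hmono t ht
    omega

/-- layer cake with weights: `Σ_b W (f b) = m·W 0 + Σ_{j<s} (W (j+1) − W j)·#{b : j+1 ≤ f b}` for `f < s`. [folklore] -/
theorem sum_weight_eq_layers {s : ℕ} (W : ℕ → ℕ) (hmono : ∀ j, j + 1 < s → W j ≤ W (j + 1))
    (f : Fin m → ℕ) (hf : ∀ b, f b < s) :
    ∑ b, W (f b) = m * W 0 + ∑ j ∈ range s, (W (j + 1) - W j) * (univ.filter fun b => j + 1 ≤ f b).card := by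
  classical
  have h1 : ∑ b, W (f b) = ∑ b : Fin m, (W 0 + ∑ j ∈ range s, if j + 1 ≤ f b then (W (j + 1) - W j) else 0) := by
    refine sum_congr rfl fun b _ => ?_
    rw [weight_eq_telescope W hmono (f b) (hf b)]
    congr 1
    rw [← sum_filter]
    refine sum_congr ?_ fun _ _ => rfl
    ext j
    simp only [mem_range, mem_filter]
    have := hf b
    omega
  rw [h1, sum_add_distrib, sum_const, card_univ, Fintype.card_fin, smul_eq_mul, sum_comm]
  congr 1
  refine sum_congr rfl fun j _ => ?_
  rw [← sum_filter, sum_const, smul_eq_mul, mul_comm]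

/-- scale counts from upper scale counts. [folklore] -/
theorem card_fiber_eq_upper_sub (f : Fin m → ℕ) (t : ℕ) :
    (univ.filter fun b => f b = t).card =
      (univ.filter fun b => t ≤ f b).card - (univ.filter fun b => t + 1 ≤ f b).card := by
  classical
  have h : (univ.filter fun b => t ≤ f b) = (univ.filter fun b => f b = t) ∪ (univ.filter fun b => t + 1 ≤ f b) := by
    ext b; simp only [mem_filter, mem_univ, true_and, mem_union]; omega
  have hdis : Disjoint (univ.filter fun b => f b = t) (univ.filter fun b => t + 1 ≤ f b) := by
    rw [disjoint_filter]; intro b _ hb; omega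
  rw [h, card_union_of_disjoint hdis]
  omega

/-- **DOMINANCE STEP ⇒ THE COMPRESSED POTENTIAL RISES.**  If every upper scale count weakly increases from `r` to `r'`
(`#{b : t ≤ sc (r b)} ≤ #{b : t ≤ sc (r' b)}` for all `t`) and the scale profiles differ, then `Σ_b W (sc (r b)) + 1 ≤ Σ_b W (sc (r' b))`
for any weights strictly increasing below `s`. [folklore: layer cake] -/
theorem sum_weight_lt_of_upper_le {s : ℕ} (sc : Fin K → ℕ) (hsc : ∀ l, sc l < s) (W : ℕ → ℕ)
    (hmono : ∀ j, j + 1 < s → W j + 1 ≤ W (j + 1)) (r r' : Fin m → Fin K)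
    (hup : ∀ t : ℕ, (univ.filter fun b => t ≤ sc (r b)).card ≤ (univ.filter fun b => t ≤ sc (r' b)).card)
    (hne : ¬ ∀ t ∈ range s, (univ.filter fun b => sc (r b) = t).card = (univ.filter fun b => sc (r' b) = t).card) :
    ∑ b, W (sc (r b)) + 1 ≤ ∑ b, W (sc (r' b)) := by
  classical
  have hmono' : ∀ j, j + 1 < s → W j ≤ W (j + 1) := fun j hj => by have := hmono j hj; omega
  rw [sum_weight_eq_layers W hmono' (fun b => sc (r b)) (fun b => hsc _),
    sum_weight_eq_layers W hmono' (fun b => sc (r' b)) (fun b => hsc _)]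
  -- some upper count with threshold `t ≥ 1`, `t < s`, strictly increases
  have hex : ∃ j ∈ range s, j + 1 < s ∧
      (univ.filter fun b => j + 1 ≤ sc (r b)).card < (univ.filter fun b => j + 1 ≤ sc (r' b)).card := by
    by_contra hcon
    push Not at hcon
    apply hne
    intro t ht
    have hall : ∀ u : ℕ, 1 ≤ u → (univ.filter fun b => u ≤ sc (r b)).card = (univ.filter fun b => u ≤ sc (r' b)).card := by
      intro u hu
      rcases Nat.lt_or_ge u s with hus | hus
      · obtain ⟨j, rfl⟩ : ∃ j, u = j + 1 := ⟨u - 1, by omega⟩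
        exact le_antisymm (hup _) (hcon j (mem_range.mpr (by omega)) hus)
      · have e : ∀ g : Fin m → Fin K, (univ.filter fun b => u ≤ sc (g b)) = ∅ := by
          intro g; ext b
          simp only [mem_filter, mem_univ, true_and, notMem_empty, iff_false, not_le]
          exact (hsc _).trans_le hus
        rw [e, e]
    have h0 : ∀ g : Fin m → Fin K, (univ.filter fun b => 0 ≤ sc (g b)).card = m := by
      intro g
      rw [filter_true_of_mem fun b _ => Nat.zero_le _, card_univ, Fintype.card_fin]
    rw [card_fiber_eq_upper_sub (fun b => sc (r b)) t, card_fiber_eq_upper_sub (fun b => sc (r' b)) t]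
    rcases Nat.eq_zero_or_pos t with rfl | htpos
    · simp only [zero_add]
      rw [h0 r, h0 r', hall 1 le_rfl]
    · rw [hall t htpos, hall (t + 1) (by omega)]
  obtain ⟨j, hj, hjs, hlt⟩ := hex
  have hterm : ∀ i ∈ range s, (W (i + 1) - W i) * (univ.filter fun b => i + 1 ≤ sc (r b)).card ≤
      (W (i + 1) - W i) * (univ.filter fun b => i + 1 ≤ sc (r' b)).card := fun i _ => Nat.mul_le_mul_left _ (hup _)
  have hstrict : (W (j + 1) - W j) * (univ.filter fun b => j + 1 ≤ sc (r b)).card + 1 ≤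
      (W (j + 1) - W j) * (univ.filter fun b => j + 1 ≤ sc (r' b)).card := by
    have hgap : 1 ≤ W (j + 1) - W j := by have := hmono j hjs; omega
    calc (W (j + 1) - W j) * (univ.filter fun b => j + 1 ≤ sc (r b)).card + 1
        ≤ (W (j + 1) - W j) * (univ.filter fun b => j + 1 ≤ sc (r b)).card + (W (j + 1) - W j) := by omega
      _ = (W (j + 1) - W j) * ((univ.filter fun b => j + 1 ≤ sc (r b)).card + 1) := by ring
      _ ≤ (W (j + 1) - W j) * (univ.filter fun b => j + 1 ≤ sc (r' b)).card := Nat.mul_le_mul_left _ hlt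
  have hsplit := fun (g : Fin m → Fin K) =>
    (add_sum_erase (range s) (fun i => (W (i + 1) - W i) * (univ.filter fun b => i + 1 ≤ sc (g b)).card) hj)
  rw [← hsplit r, ← hsplit r']
  have hrest := sum_le_sum (s := (range s).erase j) fun i hi => hterm i (mem_of_mem_erase hi)
  omega

end Terms

/-! ## 4. Compressed weights `W t = Σ_{i<t} c^i` -/

/-- the geometric weights are compressed: `c·W t + 1 ≤ W t'` for `t < t'`. [folklore] -/
theorem geom_compressed (c : ℕ) (t t' : ℕ) (htt' : t < t') :
    c * (∑ i ∈ range t, c ^ i) + 1 ≤ ∑ i ∈ range t', c ^ i := by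
  have hstep : c * (∑ i ∈ range t, c ^ i) + 1 = ∑ i ∈ range (t + 1), c ^ i := by
    rw [sum_range_succ', mul_sum, pow_zero]
    refine congrArg (· + 1) (sum_congr rfl fun i _ => by ring)
  rw [hstep]
  have hsub : range (t + 1) ⊆ range t' := by
    intro x hx
    rw [mem_range] at hx ⊢
    omega
  exact sum_le_sum_of_subset hsub

/-- the geometric weights are at most `(c+1)^t`. [folklore] -/
theorem geom_le_pow (c : ℕ) (hc : 1 ≤ c) (t : ℕ) : ∑ i ∈ range t, c ^ i ≤ (c + 1) ^ t := by
  induction t with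
  | zero => simp
  | succ t ih =>
    rw [sum_range_succ, pow_succ]
    have h1 : c ^ t ≤ (c + 1) ^ t := Nat.pow_le_pow_left (by omega) t
    have h2 : (c + 1) ^ t * 2 ≤ (c + 1) ^ t * (c + 1) := Nat.mul_le_mul_left _ (by omega)
    omega

end Summit.ValiantsHypothesis.ValiantsHypothesis.Theorems.KPlusLogSqLaw.ScaleCarries
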